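import Summits.BirchSwinnertonDyer.BirchSwinnertonDyer.Theorems.KimAtThreeDeepLowerOffStratumLevelLoweringVatsalIhara
import Summits.BirchSwinnertonDyer.BirchSwinnertonDyer.Theorems.KimAtThreeDeepLowerOffStratumLevelLoweringStabCanonicalPeriod
import Literature.NumberTheory.EllipticCurves.NewformsOldHeckeStableProofs
import HarnessLib

/-!
# Route `KimAtThreeKolyvagin` (rung W2), crux `DeepLowerAtThreeOffKatoStratum` (item 19679), registered
# stub `stub_nonAdditive`, ROAD (b²): THEOREM D′ — the NON-DEGENERACY of the `q`-stabilised plus symbol of the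
# `ℓ`-stabilised form `G = ι₁ g − t ι_ℓ g` from IHARA'S LEMMA BY NAME (`ribet1984_iharaLemma`)

Cell `bsd-addord`, seat `bsd-addord-w2-acc2`, gen 5; item `stmt-BirchSwinnertonDyer-19679` (`--supports`, closes
nothing). ROAD (b²) file 4. Gen 4's THEOREM D (`…VatsalIhara.exists_valuation_stabilisedSymbol_eq_one_of_ribet1984_iharaLemma`)
proved, for a NEWFORM `g` of level `M` and a prime `q ∤ M`: given `Ω` with `plusSymbol g/Ω` integral and a unit on one
cycle, one non-Eisenstein numeral `r₀ ≡ 1 (mod Mq)` and `c ≡ 1`, the stabilised symbol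
`(plusSymbol g x₀ − c·plusSymbol g (qx₀))/Ω` is a unit for some `x₀`. THIS FILE proves the same for the
`ℓ`-stabilised old form `G = ι₁ g − t ι_ℓ g ∈ S₂(Γ₀(M₀ℓ))` of a newform `g ∈ S₂(Γ₀(M₀))` (`ℓ ∤ M₀`): the
prime-to-`M₀ℓq` Hecke ring acts on BOTH old forms `ι₁ g`, `ι_ℓ g` through the eigencharacter of `g`
(`heckeT_iota_of_not_dvd`, real algebraic-integer eigenvalues), so the cycle functional
`Λ(y) = ((Re y(ι₁g) − t·Re y(ι_ℓ g))/Ω mod 𝔪)` on `H₁(X₀(M₀ℓ), ℤ)` is a `χ`-eigenvector carrying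
`μ = (plusSymbol G/Ω mod 𝔪)` (`plusSymbol_stabForm_eq_re`), and cell b2b-bsdres'
`exists_sub_mul_apply_ne_zero_of_ribet1984_iharaLemma` applies verbatim. Theorems only; no definition, no fact.

* §1 `exists_eigenvalue_primeTo_iota` — every `s ∈ 𝕋̃ = ℤ[T_r : r ∤ M₀ℓq]` acts on `ι₁ g` and `ι_ℓ g` by ONE real
  algebraic integer.
* §2 ★ `exists_valuation_stabilisedSymbol_eq_one_stab_of_ribet1984_iharaLemma` — THEOREM D′.

## References

* K. A. Ribet, Proc. ICM 1983 (1984), Thm. 4.1 [Ribet1984ICM]; H. Darmon, F. Diamond, R. Taylor (1995), Lemma 4.28 (a),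
  Lemma 4.30 (b), §4.5 [DarmonDiamondTaylor1995]; J. E. Cremona (1997), §2.1, §2.4 [CremonaAlgorithms1997];
  F. Diamond, J. Shurman (2005), Prop. 5.6.2, Prop. 5.8.5 [DiamondShurman2005]; G. Shimura (1971), Thm. 3.48 [Shimura1971].
-/

set_option autoImplicit false
-- the Theorems namespace of a single-conjunct summit repeats the summit name by design (D-0017)
set_option linter.dupNamespace false

noncomputable section

open scoped MatrixGroups ModularForm Classical NNReal

open CongruenceSubgroup WeierstrassCurve Literature.NumberTheory.EllipticCurves
  Literature.NumberTheory.EllipticCurves.ModularForms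
open UpperHalfPlane hiding I

namespace Summit.BirchSwinnertonDyer.BirchSwinnertonDyer.Theorems.KimAtThreeDeepLowerOffStratumLevelLoweringStabIhara

open Summit.BirchSwinnertonDyer.BirchSwinnertonDyer.Theorems.KimAtThreeDeepLowerOffStratumLevelLoweringVatsal
open Summit.BirchSwinnertonDyer.BirchSwinnertonDyer.Theorems.KimAtThreeDeepLowerOffStratumLevelLoweringVatsalStabRows
open Summit.BirchSwinnertonDyer.BirchSwinnertonDyer.Theorems.KimAtThreeDeepLowerOffStratumLevelLoweringVatsalIhara
open Summit.BirchSwinnertonDyer.BirchSwinnertonDyer.Theorems.KimAtThreeDeepLowerOffStratumLevelLoweringStabCanonicalPeriod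

/-! ### §1 The prime-to-`M₀ℓq` Hecke ring acts on `ι₁ g`, `ι_ℓ g` through the eigencharacter of `g` -/

section Eigen

variable {M₀ ℓ q : ℕ} [NeZero M₀] [NeZero ℓ] [NeZero (M₀ * ℓ)] {g : CuspForm (Gamma0 M₀) 2} (hg : IsNewform0 g)
  (h1 : M₀ * 1 ∣ M₀ * ℓ) (hℓℓ : M₀ * ℓ ∣ M₀ * ℓ)
include hg

/-- **Every `s ∈ 𝕋̃ = ℤ[T_r : r ∤ M₀ℓq]` (level `M₀ℓ`) acts on `ι₁ g` and on `ι_ℓ g` by one and the same real algebraic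
integer** (`T_r ι_d = ι_d T_r` for `r ∤ M₀ℓ`, Diamond–Shurman Prop. 5.6.2; `T_r g = a_r(g) g` with `a_r(g)` a real
algebraic integer; induction on `Algebra.adjoin`). [cite: DiamondShurman2005, Prop. 5.6.2 (proof, first diagram)]
[cite: Shimura1971, Thm. 3.48] -/
theorem exists_eigenvalue_primeTo_iota (s : HeckeRing0.primeTo (M₀ * ℓ) 2 (M₀ * ℓ * q)) :
    ∃ c : ℂ, HeckeRing0.toEnd (M₀ * ℓ) 2 (s : HeckeRing0 (M₀ * ℓ) 2) (iota M₀ (M₀ * ℓ) 1 2 h1 g) =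
        c • iota M₀ (M₀ * ℓ) 1 2 h1 g ∧
      HeckeRing0.toEnd (M₀ * ℓ) 2 (s : HeckeRing0 (M₀ * ℓ) 2) (iota M₀ (M₀ * ℓ) ℓ 2 hℓℓ g) =
        c • iota M₀ (M₀ * ℓ) ℓ 2 hℓℓ g ∧ IsIntegral ℤ c ∧ c.im = 0 := by
  obtain ⟨s, hs⟩ := s
  refine Algebra.adjoin_induction (p := fun e _ => ∃ c : ℂ,
      HeckeRing0.toEnd (M₀ * ℓ) 2 e (iota M₀ (M₀ * ℓ) 1 2 h1 g) = c • iota M₀ (M₀ * ℓ) 1 2 h1 g ∧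
      HeckeRing0.toEnd (M₀ * ℓ) 2 e (iota M₀ (M₀ * ℓ) ℓ 2 hℓℓ g) = c • iota M₀ (M₀ * ℓ) ℓ 2 hℓℓ g ∧
      IsIntegral ℤ c ∧ c.im = 0) ?_ ?_ ?_ ?_ hs
  · rintro e ⟨r, hr, hrS, rfl⟩
    haveI : NeZero r := ⟨hr.ne_zero⟩
    have hrℓ : ¬ r ∣ ℓ := fun h ↦ hrS ((h.mul_left M₀).mul_right q)
    have hr1 : ¬ r ∣ 1 := hr.not_dvd_one
    have hrM₀ : ¬ r ∣ M₀ := fun h ↦ hrS ((h.mul_right ℓ).mul_right q)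
    have hrM : ¬ r ∣ M₀ * ℓ := fun h ↦ hrS (h.mul_right q)
    have hiff : r ∣ M₀ ↔ r ∣ M₀ * ℓ := ⟨fun h ↦ absurd h hrM₀, fun h ↦ absurd h hrM⟩
    refine ⟨cuspCoeff g r, ?_, ?_, IsNewform0.isIntegral_coeff_holds hg r, hg.cuspCoeff_im_eq_zero r⟩
    · rw [HeckeRing0.toEnd_T, heckeT_iota_of_not_dvd h1 hr hr1 hiff, hg.heckeT_eq_coeff_smul hr, map_smul]; rfl
    · rw [HeckeRing0.toEnd_T, heckeT_iota_of_not_dvd hℓℓ hr hrℓ hiff, hg.heckeT_eq_coeff_smul hr, map_smul]; rfl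
  · intro n
    refine ⟨(n : ℂ), ?_, ?_, isIntegral_algebraMap.map (Int.castRingHom ℂ).toIntAlgHom, by simp⟩
    · rw [eq_intCast, map_intCast, Module.End.intCast_apply, Int.cast_smul_eq_zsmul]
    · rw [eq_intCast, map_intCast, Module.End.intCast_apply, Int.cast_smul_eq_zsmul]
  · rintro e₁ e₂ _ _ ⟨c₁, h₁, h₁', i₁, r₁⟩ ⟨c₂, h₂, h₂', i₂, r₂⟩
    refine ⟨c₁ + c₂, ?_, ?_, i₁.add i₂, by simp [r₁, r₂]⟩
    · rw [map_add, LinearMap.add_apply, h₁, h₂, add_smul]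
    · rw [map_add, LinearMap.add_apply, h₁', h₂', add_smul]
  · rintro e₁ e₂ _ _ ⟨c₁, h₁, h₁', i₁, r₁⟩ ⟨c₂, h₂, h₂', i₂, r₂⟩
    refine ⟨c₁ * c₂, ?_, ?_, i₁.mul i₂, by simp [r₁, r₂]⟩
    · rw [map_mul, Module.End.mul_apply, h₂, map_smul, h₁, smul_smul, mul_comm c₂ c₁]
    · rw [map_mul, Module.End.mul_apply, h₂', map_smul, h₁', smul_smul, mul_comm c₂ c₁]

end Eigen

/-! ### §2 THEOREM D′: Ihara's lemma BY NAME ⟹ the non-degeneracy for the `ℓ`-stabilised form -/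

section Ihara

open Summit.BirchSwinnertonDyer.Rank1Residual.LevelLowering

variable {M₀ ℓ q : ℕ} [NeZero M₀] [NeZero ℓ] [NeZero (M₀ * ℓ)] {g : CuspForm (Gamma0 M₀) 2}
  (h1 : M₀ * 1 ∣ M₀ * ℓ) (hℓℓ : M₀ * ℓ ∣ M₀ * ℓ)

/-- ★ **THEOREM D′ — the NON-DEGENERACY input of THEOREM A for `G = ι₁ g − t ι_ℓ g` from `ribet1984_iharaLemma` BY
NAME.** Let `g` be a newform on `Γ₀(M₀)`, `t ∈ ℂ`, `G = ι₁ g − t ι_ℓ g ∈ S₂(Γ₀(M₀ℓ))`, `q ∤ M₀ℓ` a prime, `Ω ∈ ℂ` with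
`plusSymbol G x/Ω` integral for all `x ∈ ℚ` and a UNIT at some cusp `γ₀∞`, `γ₀ ∈ Γ₀(M₀ℓ)`, a prime `r₀ ≡ 1 (mod M₀ℓq)`,
`r₀ ∤ M₀ℓq`, with `a_{r₀}(g) ≢ r₀ + 1 (mod 𝔪)`, and `c ≡ 1`. Then `(plusSymbol G x₀ − c·plusSymbol G (q x₀))/Ω` is a
unit for some `x₀ ∈ ℚ`. Proof = THEOREM D's, with the cycle functional
`Λ(y) = ((Re y(ι₁g) − t·Re y(ι_ℓ g))/Ω mod 𝔪)` and the eigencharacter of §1.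
[cite: Ribet1984ICM, Thm. 4.1] [cite: DarmonDiamondTaylor1995, Lemma 4.28 (a), Lemma 4.30 (b), §4.5 pp. 135–137]
[cite: CremonaAlgorithms1997, §2.4] -/
theorem exists_valuation_stabilisedSymbol_eq_one_stab_of_ribet1984_iharaLemma (hI : ribet1984_iharaLemma)
    (hq : q.Prime) (hqM : ¬ q ∣ M₀ * ℓ) (hg : IsNewform0 g) (t : ℂ) (ι : PadicAlgCl 3 ≃+* ℂ) {Ω : ℂ}
    (hΩint : ∀ x : ℚ, Valued.v (ι.symm (plusSymbol (iota M₀ (M₀ * ℓ) 1 2 h1 g - t • iota M₀ (M₀ * ℓ) ℓ 2 hℓℓ g) x / Ω)) ≤ 1)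
    (γ₀ : Gamma0 (M₀ * ℓ)) (hγ₀ : (γ₀ : SL(2, ℤ)) 1 0 ≠ 0)
    (hunit : Valued.v (ι.symm (plusSymbol (iota M₀ (M₀ * ℓ) 1 2 h1 g - t • iota M₀ (M₀ * ℓ) ℓ 2 hℓℓ g)
      ((((γ₀ : SL(2, ℤ)) 0 0 : ℤ) : ℚ) / (((γ₀ : SL(2, ℤ)) 1 0 : ℤ) : ℚ)) / Ω)) = 1)
    {r₀ : ℕ} (hr₀ : r₀.Prime) (hr₀S : ¬ r₀ ∣ M₀ * ℓ * q) (hr₀1 : r₀ ≡ 1 [MOD M₀ * ℓ * q])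
    (hE₀ : Valued.v (ι.symm (cuspCoeff g r₀ - (r₀ + 1))) = 1)
    {c : ℂ} (hc : Valued.v (ι.symm (c - 1)) < 1) :
    ∃ x₀ : ℚ, Valued.v (ι.symm ((plusSymbol (iota M₀ (M₀ * ℓ) 1 2 h1 g - t • iota M₀ (M₀ * ℓ) ℓ 2 hℓℓ g) x₀ -
      c * plusSymbol (iota M₀ (M₀ * ℓ) 1 2 h1 g - t • iota M₀ (M₀ * ℓ) ℓ 2 hℓℓ g) (q * x₀)) / Ω)) = 1 := by
  classical
  haveI : Fact q.Prime := ⟨hq⟩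
  haveI := charP_residueField
  set res := IsLocalRing.residue (Valued.integer (PadicAlgCl 3)) with hres
  set A := iota M₀ (M₀ * ℓ) 1 2 h1 g with hA
  set B := iota M₀ (M₀ * ℓ) ℓ 2 hℓℓ g with hB
  set G := A - t • B with hG
  have hreal : ∀ n, (cuspCoeff g n).im = 0 := hg.cuspCoeff_im_eq_zero
  have hplus : ∀ x : ℚ, plusSymbol G x = (((modularSymbol A x).re : ℝ) : ℂ) - t * (((modularSymbol B x).re : ℝ) : ℂ) :=
    fun x => plusSymbol_stabForm_eq_re g t h1 hℓℓ hreal x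
  -- (a) the eigencharacter on `𝕋̃`: `toEnd s A = lam s • A`, `toEnd s B = lam s • B`, `lam s` real integral
  have hA1 : cuspCoeff A 1 = 1 := by
    rw [hA, cuspCoeff, qExpansion_coeff_iota, if_pos (one_dvd 1), Nat.div_one]
    exact hg.2.2
  set lam : HeckeRing0.primeTo (M₀ * ℓ) 2 (M₀ * ℓ * q) → ℂ :=
    fun s => cuspCoeff (HeckeRing0.toEnd (M₀ * ℓ) 2 (s : HeckeRing0 (M₀ * ℓ) 2) A) 1 with hlam
  have hlam_one_coeff : ∀ a : ℂ, cuspCoeff (a • A) 1 = a := fun a => by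
    rw [cuspCoeff, qExpansion_coeff_smul, show (qExpansion 1 ⇑A).coeff 1 = 1 from hA1, mul_one]
  have hlamA : ∀ s : HeckeRing0.primeTo (M₀ * ℓ) 2 (M₀ * ℓ * q),
      HeckeRing0.toEnd (M₀ * ℓ) 2 (s : HeckeRing0 (M₀ * ℓ) 2) A = lam s • A ∧
      HeckeRing0.toEnd (M₀ * ℓ) 2 (s : HeckeRing0 (M₀ * ℓ) 2) B = lam s • B ∧ ‖ι.symm (lam s)‖ ≤ 1 ∧ (lam s).im = 0 := by
    intro s
    obtain ⟨e, heA, heB, hi, hr⟩ := exists_eigenvalue_primeTo_iota hg h1 hℓℓ s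
    have hle : lam s = e := by
      show cuspCoeff (HeckeRing0.toEnd (M₀ * ℓ) 2 (s : HeckeRing0 (M₀ * ℓ) 2) A) 1 = e
      rw [heA, hlam_one_coeff]
    rw [hle]
    exact ⟨heA, heB, norm_le_one_of_isIntegral_int (hi.map (ι.symm : ℂ →+* PadicAlgCl 3).toIntAlgHom), hr⟩
  let lamHom : HeckeRing0.primeTo (M₀ * ℓ) 2 (M₀ * ℓ * q) →+* ℂ :=
    { toFun := lam
      map_one' := by
        show cuspCoeff (HeckeRing0.toEnd (M₀ * ℓ) 2 ((1 : HeckeRing0.primeTo (M₀ * ℓ) 2 (M₀ * ℓ * q)) :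
          HeckeRing0 (M₀ * ℓ) 2) A) 1 = 1
        rw [OneMemClass.coe_one, map_one, Module.End.one_apply]
        exact hA1
      map_mul' := fun s s' => by
        show cuspCoeff (HeckeRing0.toEnd (M₀ * ℓ) 2 ((s * s' : HeckeRing0.primeTo (M₀ * ℓ) 2 (M₀ * ℓ * q)) :
          HeckeRing0 (M₀ * ℓ) 2) A) 1 = lam s * lam s'
        rw [Subalgebra.coe_mul, map_mul, Module.End.mul_apply, (hlamA s').1, map_smul, (hlamA s).1, smul_smul,
          hlam_one_coeff, mul_comm]
      map_zero' := by
        show cuspCoeff (HeckeRing0.toEnd (M₀ * ℓ) 2 ((0 : HeckeRing0.primeTo (M₀ * ℓ) 2 (M₀ * ℓ * q)) :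
          HeckeRing0 (M₀ * ℓ) 2) A) 1 = 0
        rw [ZeroMemClass.coe_zero, map_zero, LinearMap.zero_apply, ← zero_smul ℂ A, hlam_one_coeff]
      map_add' := fun s s' => by
        show cuspCoeff (HeckeRing0.toEnd (M₀ * ℓ) 2 ((s + s' : HeckeRing0.primeTo (M₀ * ℓ) 2 (M₀ * ℓ * q)) :
          HeckeRing0 (M₀ * ℓ) 2) A) 1 = lam s + lam s'
        rw [Subalgebra.coe_add, map_add, LinearMap.add_apply, (hlamA s).1, (hlamA s').1, ← add_smul, hlam_one_coeff] }
  have hlamHom : ∀ s, lamHom s = lam s := fun _ => rfl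
  -- (b) `χ : 𝕋̃ → 𝓀`
  let χ₀ : HeckeRing0.primeTo (M₀ * ℓ) 2 (M₀ * ℓ * q) →+* (Valued.integer (PadicAlgCl 3)) :=
    ((ι.symm : ℂ →+* PadicAlgCl 3).comp lamHom).codRestrict (Valued.integer (PadicAlgCl 3)) fun s =>
      mem_integer_iff_norm_le_one.mpr (hlamA s).2.2.1
  have hχ₀ : ∀ s, (χ₀ s : PadicAlgCl 3) = ι.symm (lam s) := fun _ => rfl
  let χ : HeckeRing0.primeTo (M₀ * ℓ) 2 (M₀ * ℓ * q) →+* IsLocalRing.ResidueField (Valued.integer (PadicAlgCl 3)) :=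
    res.comp χ₀
  have hχ : ∀ s, χ s = res (χ₀ s) := fun _ => rfl
  -- (c) `ker χ` is maximal
  have h3ker : (3 : HeckeRing0.primeTo (M₀ * ℓ) 2 (M₀ * ℓ * q)) ∈ RingHom.ker χ := by
    rw [RingHom.mem_ker, map_ofNat]
    exact CharP.cast_eq_zero _ 3
  haveI hfinT : Module.Finite ℤ (HeckeRing0.primeTo (M₀ * ℓ) 2 (M₀ * ℓ * q)) :=
    Module.Finite.of_injective (HeckeRing0.primeTo (M₀ * ℓ) 2 (M₀ * ℓ * q)).val.toLinearMap Subtype.val_injective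
  have h𝔫 : (RingHom.ker χ).IsMaximal := by
    set Q := HeckeRing0.primeTo (M₀ * ℓ) 2 (M₀ * ℓ * q) ⧸ RingHom.ker χ with hQ
    haveI : IsDomain Q := (RingHom.quotientKerEquivRange χ).toMulEquiv.isDomain
    haveI : Module.Finite ℤ Q := Module.Finite.of_surjective
      (Ideal.Quotient.mkₐ ℤ (RingHom.ker χ)).toLinearMap (Ideal.Quotient.mkₐ_surjective ℤ _)
    haveI : AddGroup.FG Q := Module.Finite.iff_addGroup_fg.mp inferInstance
    have h3Q : (3 : Q) = 0 := by
      have h := Ideal.Quotient.eq_zero_iff_mem.mpr h3ker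
      rwa [map_ofNat] at h
    have htors : AddMonoid.IsTorsion Q := by
      intro x
      rw [isOfFinAddOrder_iff_nsmul_eq_zero]
      refine ⟨3, by norm_num, ?_⟩
      rw [nsmul_eq_mul, Nat.cast_ofNat, h3Q, zero_mul]
    haveI : Finite Q := AddCommGroup.finite_of_fg_torsion Q htors
    exact Ideal.Quotient.maximal_of_isField _ (Finite.isField_of_domain Q)
  have h2 : (2 : IsLocalRing.ResidueField (Valued.integer (PadicAlgCl 3))) ≠ 0 := by
    intro h
    have h3 : (3 : IsLocalRing.ResidueField (Valued.integer (PadicAlgCl 3))) = 0 := by exact_mod_cast CharP.cast_eq_zero _ 3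
    have : (1 : IsLocalRing.ResidueField (Valued.integer (PadicAlgCl 3))) = 0 := by
      have e : (3 : IsLocalRing.ResidueField (Valued.integer (PadicAlgCl 3))) - 2 = 1 := by norm_num
      rw [← e, h, h3, sub_zero]
    exact one_ne_zero this
  -- (d) `ker χ` is not Eisenstein: the numeral `r₀`
  have hE : ¬ HeckeRing0.primeTo.IsEisenstein (RingHom.ker χ) := by
    intro hEis
    have hmem := hEis r₀ hr₀ hr₀S hr₀1
    rw [RingHom.mem_ker, map_sub, hχ] at hmem
    have hT : lam (HeckeRing0.primeTo.T (M₀ * ℓ) 2 (M₀ * ℓ * q) hr₀ hr₀S) = cuspCoeff g r₀ := by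
      haveI : NeZero r₀ := ⟨hr₀.ne_zero⟩
      have hr₀M : ¬ r₀ ∣ M₀ * ℓ := fun h => hr₀S (h.mul_right q)
      have hr₀M₀ : ¬ r₀ ∣ M₀ := fun h => hr₀M (h.mul_right ℓ)
      show cuspCoeff (HeckeRing0.toEnd (M₀ * ℓ) 2 (HeckeRing0.T (M₀ * ℓ) 2 r₀ hr₀) A) 1 = cuspCoeff g r₀
      rw [HeckeRing0.toEnd_T, hA, heckeT_iota_of_not_dvd h1 hr₀ hr₀.not_dvd_one ⟨fun h => absurd h hr₀M₀, fun h => absurd h hr₀M⟩,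
        hg.heckeT_eq_coeff_smul hr₀, map_smul, ← hA, hlam_one_coeff]
      rfl
    have hval : res (χ₀ (HeckeRing0.primeTo.T (M₀ * ℓ) 2 (M₀ * ℓ * q) hr₀ hr₀S)) -
        ((r₀ : IsLocalRing.ResidueField (Valued.integer (PadicAlgCl 3))) + 1) = 0 := by
      have : χ ((r₀ : HeckeRing0.primeTo (M₀ * ℓ) 2 (M₀ * ℓ * q)) + 1) =
          (r₀ : IsLocalRing.ResidueField (Valued.integer (PadicAlgCl 3))) + 1 := by
        rw [map_add, map_natCast, map_one]
      rwa [this] at hmem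
    have hmemO : ι.symm (cuspCoeff g r₀ - (r₀ + 1)) ∈ (Valued.integer (PadicAlgCl 3)) :=
      mem_integer_iff_norm_le_one.mpr (valuation_eq_one_iff.mp hE₀).le
    have hunit' : res ⟨ι.symm (cuspCoeff g r₀ - (r₀ + 1)), hmemO⟩ ≠ 0 := by
      rw [Ne, IsLocalRing.residue_eq_zero_iff, IsLocalRing.mem_maximalIdeal, mem_nonunits_iff, not_not,
        Valuation.Integers.isUnit_iff_valuation_eq_one (Valuation.integer.integers _)]
      exact hE₀
    apply hunit'
    have heq : (⟨ι.symm (cuspCoeff g r₀ - (r₀ + 1)), hmemO⟩ : (Valued.integer (PadicAlgCl 3))) =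
        χ₀ (HeckeRing0.primeTo.T (M₀ * ℓ) 2 (M₀ * ℓ * q) hr₀ hr₀S) - ((r₀ : (Valued.integer (PadicAlgCl 3))) + 1) := by
      apply Subtype.ext
      push_cast
      rw [hχ₀, hT, map_sub, map_add, map_natCast, map_one]
    rw [heq, map_sub, map_add, map_natCast, map_one]
    exact hval
  -- (e) the cycle functional `Λ`
  let R : ℂ → IsLocalRing.ResidueField (Valued.integer (PadicAlgCl 3)) := fun z =>
    if h : ‖ι.symm z‖ ≤ 1 then res ⟨ι.symm z, mem_integer_iff_norm_le_one.mpr h⟩ else 0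
  have hR : ∀ {z : ℂ} (h : ‖ι.symm z‖ ≤ 1), R z = res ⟨ι.symm z, mem_integer_iff_norm_le_one.mpr h⟩ :=
    fun h => dif_pos h
  let P : Module.Dual ℂ (CuspForm (Gamma0 (M₀ * ℓ)) 2) → ℂ :=
    fun y => (((y A).re : ℝ) : ℂ) - t * (((y B).re : ℝ) : ℂ)
  let Λ : Module.Dual ℂ (CuspForm (Gamma0 (M₀ * ℓ)) 2) → IsLocalRing.ResidueField (Valued.integer (PadicAlgCl 3)) :=
    fun y => R (P y / Ω)
  let μ : ℚ → IsLocalRing.ResidueField (Valued.integer (PadicAlgCl 3)) := fun r => R (plusSymbol G r / Ω)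
  have hcycle : ∀ x ∈ periodHomology (M₀ * ℓ), ‖ι.symm (P x / Ω)‖ ≤ 1 := by
    intro x hx
    have hx' : x ∈ (periodHomology (M₀ * ℓ) : Set (Module.Dual ℂ (CuspForm (Gamma0 (M₀ * ℓ)) 2))) := hx
    rw [coe_periodHomology_eq_range] at hx'
    obtain ⟨γ, rfl⟩ := hx'
    show ‖ι.symm (((((periodFunctional (M₀ * ℓ) γ A).re : ℝ) : ℂ) - t * ((((periodFunctional (M₀ * ℓ) γ B).re : ℝ) : ℂ))) / Ω)‖ ≤ 1
    rw [periodFunctional_apply, periodFunctional_apply, cuspSymbol, cuspSymbol]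
    split_ifs with hc0
    · rw [Complex.zero_re, Complex.ofReal_zero, mul_zero, sub_zero, zero_div, map_zero, norm_zero]
      exact zero_le_one
    · rw [← hplus]
      exact valuation_le_one_iff.mp (hΩint _)
  have hΛ : ∀ (s : HeckeRing0.primeTo (M₀ * ℓ) 2 (M₀ * ℓ * q)), ∀ x ∈ periodHomology (M₀ * ℓ),
      Λ ((s : HeckeRing0 (M₀ * ℓ) 2) • x) = χ s * Λ x := by
    intro s x hx
    obtain ⟨hsA, hsB, hint, hrl⟩ := hlamA s
    have hsxA : ((s : HeckeRing0 (M₀ * ℓ) 2) • x) A = lam s * x A := by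
      rw [HeckeRing0.smul_dual_apply, hsA, map_smul, smul_eq_mul]
    have hsxB : ((s : HeckeRing0 (M₀ * ℓ) 2) • x) B = lam s * x B := by
      rw [HeckeRing0.smul_dual_apply, hsB, map_smul, smul_eq_mul]
    have hreal_lam : ∀ z : ℂ, (((lam s * z).re : ℝ) : ℂ) = lam s * (((z.re : ℝ) : ℂ)) := by
      intro z
      rw [Complex.mul_re, hrl, zero_mul, sub_zero, Complex.ofReal_mul]
      congr 1
      exact Complex.ext (by simp) (by simp [hrl])
    have hre : P ((s : HeckeRing0 (M₀ * ℓ) 2) • x) / Ω = lam s * (P x / Ω) := by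
      show ((((((s : HeckeRing0 (M₀ * ℓ) 2) • x) A).re : ℝ) : ℂ) - t * (((((s : HeckeRing0 (M₀ * ℓ) 2) • x) B).re : ℝ) : ℂ)) / Ω =
        lam s * (((((x A).re : ℝ) : ℂ) - t * (((x B).re : ℝ) : ℂ)) / Ω)
      rw [hsxA, hsxB, hreal_lam, hreal_lam]
      ring
    have h1' : ‖ι.symm (lam s)‖ ≤ 1 := hint
    have h2' := hcycle x hx
    have h12 : ‖ι.symm (lam s * (P x / Ω))‖ ≤ 1 := by
      rw [map_mul, norm_mul]; exact mul_le_one₀ h1' (norm_nonneg _) h2'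
    show R _ = χ s * R _
    rw [hre, hR h12, hR h2', hχ, ← map_mul]
    congr 1
    apply Subtype.ext
    push_cast
    rw [map_mul, hχ₀]
  have hμΛ : ∀ y ∈ periodHomology (M₀ * ℓ), ∀ r : ℚ,
      (∀ f : CuspForm (Gamma0 (M₀ * ℓ)) 2, y f = modularSymbol f r) → μ r = Λ y := by
    intro y _ r hy
    show R _ = R ((((((y A).re : ℝ) : ℂ) - t * (((y B).re : ℝ) : ℂ))) / Ω)
    rw [hplus r, hy A, hy B]
  have hx₀ : periodFunctional (M₀ * ℓ) γ₀ ∈ periodHomology (M₀ * ℓ) := periodFunctional_mem_periodHomology (M₀ * ℓ) γ₀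
  have hΛx : Λ (periodFunctional (M₀ * ℓ) γ₀) ≠ 0 := by
    have hPγ : P (periodFunctional (M₀ * ℓ) γ₀) / Ω =
        plusSymbol G ((((γ₀ : SL(2, ℤ)) 0 0 : ℤ) : ℚ) / (((γ₀ : SL(2, ℤ)) 1 0 : ℤ) : ℚ)) / Ω := by
      show ((((periodFunctional (M₀ * ℓ) γ₀ A).re : ℝ) : ℂ) - t * ((((periodFunctional (M₀ * ℓ) γ₀ B).re : ℝ) : ℂ))) / Ω = _
      rw [periodFunctional_apply, periodFunctional_apply, cuspSymbol, cuspSymbol, if_neg hγ₀, if_neg hγ₀, hplus]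
    show R _ ≠ 0
    rw [hPγ, hR (valuation_eq_one_iff.mp hunit).le]
    rw [Ne, IsLocalRing.residue_eq_zero_iff, IsLocalRing.mem_maximalIdeal, mem_nonunits_iff, not_not,
      Valuation.Integers.isUnit_iff_valuation_eq_one (Valuation.integer.integers _)]
    exact hunit
  -- (f) Ihara
  obtain ⟨r, hr⟩ := exists_sub_mul_apply_ne_zero_of_ribet1984_iharaLemma hI hqM Λ χ hΛ h𝔫 h2 hE hx₀ hΛx
    (1 : IsLocalRing.ResidueField (Valued.integer (PadicAlgCl 3))) hμΛ
  refine ⟨r, ?_⟩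
  have hA' := valuation_le_one_iff.mp (hΩint r)
  have hB' := valuation_le_one_iff.mp (hΩint (q * r))
  have hC : ‖ι.symm c‖ ≤ 1 := by
    have : ι.symm c = ι.symm (c - 1) + 1 := by rw [map_sub, map_one, sub_add_cancel]
    rw [this]
    exact (PadicAlgCl.isNonarchimedean 3 _ _).trans (max_le (valuation_lt_one_iff.mp hc).le (by rw [norm_one]))
  have hc1 : res ⟨ι.symm c, mem_integer_iff_norm_le_one.mpr hC⟩ = 1 := by
    have h := residue_mk_eq_of_norm_sub_lt_one (mem_integer_iff_norm_le_one.mpr hC)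
      (one_mem (Valued.integer (PadicAlgCl 3))) (by
      rw [← map_one ι.symm, ← map_sub]; exact valuation_lt_one_iff.mp hc)
    rw [h]; exact map_one res
  have hABC : ‖ι.symm ((plusSymbol G r - c * plusSymbol G (q * r)) / Ω)‖ ≤ 1 := by
    rw [sub_div, mul_div_assoc, map_sub, map_mul, sub_eq_add_neg]
    refine (PadicAlgCl.isNonarchimedean 3 _ _).trans (max_le hA' ?_)
    rw [norm_neg, norm_mul]; exact mul_le_one₀ hC (norm_nonneg _) hB'
  have hresid : res ⟨ι.symm ((plusSymbol G r - c * plusSymbol G (q * r)) / Ω), mem_integer_iff_norm_le_one.mpr hABC⟩ =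
      μ r - 1 * μ (q * r) := by
    show _ = R _ - 1 * R _
    rw [hR hA', hR hB', ← hc1, ← map_mul, ← map_sub]
    congr 1
    apply Subtype.ext
    push_cast
    rw [sub_div, mul_div_assoc, map_sub, map_mul]
  refine valuation_eq_one_iff.mpr (le_antisymm hABC ?_)
  by_contra hlt
  push Not at hlt
  apply hr
  rw [← hresid]
  exact residue_mk_eq_zero_of_norm_lt_one _ hlt

end Ihara

end Summit.BirchSwinnertonDyer.BirchSwinnertonDyer.Theorems.KimAtThreeDeepLowerOffStratumLevelLoweringStabIhara

end
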